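import Summits.AtomisticToContinuum.FouriersLaw.Theorems.OddSectorIrreversibilityCorrectorTheoryUniformMixing
import Summits.AtomisticToContinuum.FouriersLaw.Theorems.OddSectorIrreversibilityResponseDensityLinearResponse
import Summits.AtomisticToContinuum.FouriersLaw.Theorems.EmbeddedDrudeMourreNessUnique
import HarnessLib

/-!
# Crux `ExtensiveSnapshotIrreversibility` (stmt-AtomisticToContinuum-9121), line `clausius-budget-sound-window`:
sub-goal `ness_gibbs_integral_sub_le` — the `L¹` half of clause (R0) of stub S1r' `stub_oddLogDensityRegularity`

The registered sub-goal `ness_gibbs_integral_sub_le` (worker sub-goal toward clause (R0) of stub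
S1r' `stub_oddLogDensityRegularity` of the lead's checked skeleton v8): **the two-temperature steady
state is `O(δ)`-close to the Gibbs state at the mean temperature, uniformly over exponentially
weighted observables.** For the pinned anharmonic chain `P = pinnedChain ω₂ lam β γ` (all parameters
positive), along EVERY steady-state family `μ` (no uniqueness guard), for `T > 0` and `N ≥ 1` there are
`δ₀ ∈ (0, 2T)`, `ϑ > 0` and `K ≥ 0` with

  `|∫ φ dμ_{N,T+δ/2,T-δ/2} - ∫ φ dμ_T| ≤ K |δ|`   for all `|δ| < δ₀`, `φ ∈ C²`, `|φ| ≤ e^{ϑH}`,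

`μ_T = P.gibbsMeasure N T`. Equivalently `‖e^{ϑH}(μ_δ - μ_T)‖_{TV} = ∫ e^{ϑH} |e^{φ_δ} - 1| dμ_T ≤ K|δ|`
for the NESS log-density `φ_δ` of (R1): clause (R0) (`φ_δ → 0`) holds in `L¹(e^{ϑH} μ_T)` with RATE
`δ`, hence in `μ_T`-measure; what (R0) asks beyond this — convergence at EVERY point — is exactly a
`δ`-uniform local regularity statement for the NESS densities (see the worker's recon).

Proof (assembly of landed facts, no new analysis): every weak steady state is invariant for the
constructed kernels (`pinnedChain_isInvariant_of_isSteadyState`); the exact response identity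
`Z μ_δ(φ) - ∫ e^{-H/T} φ = δ (γ/2T²) ∫₀^∞ ∫ P^δ_s φ · e^{-H/T}(p_0² - p_{N-1}²) dx ds`
(`pinnedChain_exact_response_identity`); the odd-moment pairing decays like `e^{-cs}` with constants
controlled by the mixing constants (`abs_oddMoment_pairing_le_of_mixing`), which are UNIFORM in
`|δ| < δ₀` (`Corrector.pinnedChain_uniformMixing`, CEHR (2.5) with uniform Harris constants); hence the
right-hand side is `≤ |δ| (γ/2T²) B/c`.

References: Cuneo–Eckmann–Hairer–Rey-Bellet, EJP 23 (2018) no. 55, Thm 2.13 (3); M. Hairer,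
A. J. Majda, Nonlinearity 23 (2010) 909–922 (linear response framework).
-/

noncomputable section

namespace Summit.AtomisticToContinuum.FouriersLaw.Theorems.ExtensiveSnapshotIrreversibility.ClausiusBudget

open MeasureTheory Filter Topology Set
open scoped ENNReal NNReal
open Literature.MathematicalPhysics.KineticTheory.HeatConduction
open Literature.MathematicalPhysics.KineticTheory Literature.Probability.Process OscillatorChain

namespace LogDensity

/-- **`O(δ)`-closeness of the two-temperature NESS to the Gibbs state, uniformly over weighted
observables** (registered worker sub-goal `ness_gibbs_integral_sub_le`, the `L¹` half of clause (R0)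
of stub S1r', line `clausius-budget-sound-window`). Along every steady-state family `μ` of the pinned
chain (all parameters `> 0`), for `T > 0`, `N ≥ 1`: there are `δ₀ ∈ (0, 2T)`, `ϑ > 0`, `K ≥ 0` with
`|∫ φ dμ_{N,T+δ/2,T-δ/2} - ∫ φ d(gibbsMeasure N T)| ≤ K |δ|` for all `|δ| < δ₀` and all `φ ∈ C²` with
`|φ| ≤ e^{ϑH}`. Exact response identity + `δ`-uniform exponential mixing.
[cite: CuneoEckmannHairerReyBellet2018, Thm 2.13 (3)] -/
theorem ness_gibbs_integral_sub_le :
    ∀ ω₂ lam β γ : ℝ, 0 < ω₂ → 0 < lam → 0 < β → 0 < γ →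
      ∀ μ : (N : ℕ) → ℝ → ℝ → Measure (PhaseSpace N),
        (∀ (N : ℕ) (T_L T_R : ℝ), 0 < T_L → 0 < T_R →
          (pinnedChain ω₂ lam β γ).IsSteadyState N T_L T_R (μ N T_L T_R)) →
        ∀ T : ℝ, 0 < T → ∀ N : ℕ, 0 < N →
          ∃ δ₀ ϑ K : ℝ, 0 < δ₀ ∧ δ₀ < 2 * T ∧ 0 < ϑ ∧ 0 ≤ K ∧
            ∀ δ : ℝ, |δ| < δ₀ → ∀ φ : PhaseSpace N → ℝ, ContDiff ℝ 2 φ →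
              (∀ y, |φ y| ≤ Real.exp (ϑ * (pinnedChain ω₂ lam β γ).hamiltonian N y)) →
              |(∫ y, φ y ∂(μ N (T + δ / 2) (T - δ / 2))) -
                  ∫ y, φ y ∂((pinnedChain ω₂ lam β γ).gibbsMeasure N T)| ≤ K * |δ| := by
  intro ω₂ lam β γ hω hl hβ hγ μ hμ T hT N hN
  set P := pinnedChain ω₂ lam β γ with hP
  -- `δ`-uniform mixing constants
  obtain ⟨δ₀, ϑ, Cm, c, hδ₀, hδ₀T, hϑ, hϑT, -, hCm, hc, hUM⟩ :=
    OddSectorIrreversibility.Corrector.pinnedChain_uniformMixing (N := N) hω hl.le hβ hγ hN hT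
  -- the partition function and the weight integral
  set Z : ℝ := ∫ x : PhaseSpace N, Real.exp (-1 / T * P.hamiltonian N x) with hZ
  have hIθ := integrable_exp_mul_hamiltonian hω hl.le hβ.le γ (N := N) (c := -1 / T)
    (by rw [neg_div]; exact neg_neg_of_pos (one_div_pos.2 hT))
  have hZ0 : 0 < Z := integral_exp_pos hIθ
  set W : ℝ := ∫ x : PhaseSpace N, (1 + x.2 ⟨0, hN⟩ ^ 2 + x.2 ⟨N - 1, by omega⟩ ^ 2) *
    Real.exp ((-1 / T + ϑ) * P.hamiltonian N x) with hW
  have hW0 : 0 ≤ W := integral_nonneg fun x => by positivity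
  set B : ℝ := max 1 1 * Cm * W with hB
  have hB0 : 0 ≤ B := by positivity
  refine ⟨δ₀, ϑ, γ / (2 * T ^ 2) * (B / c) / Z, hδ₀, hδ₀T, hϑ, by positivity, fun δ hδ φ hφ2 hφ => ?_⟩
  obtain ⟨hTL, hTR, hϑ'⟩ := bath_facts_of_abs_lt hδ₀T hϑT hδ
  have hφ' : ∀ y, |φ y| ≤ 1 * Real.exp (ϑ * P.hamiltonian N y) := fun y => by rw [one_mul]; exact hφ y
  -- the steady state is invariant for the constructed kernels
  set ν := μ N (T + δ / 2) (T - δ / 2) with hν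
  have hss : P.IsSteadyState N (T + δ / 2) (T - δ / 2) ν := hμ N _ _ hTL hTR
  haveI : IsProbabilityMeasure ν := hss.1
  have hinv := pinnedChain_isInvariant_of_isSteadyState hω hl hβ hγ hN hTL hTR hss
  have hinv' : ∀ t : ℝ≥0, ν.bind (P.transitionKernel N (T + δ / 2) (T - δ / 2) t) = ν := fun t => hinv t
  set A : ℝ := ∫ x : PhaseSpace N, Real.exp (-1 / T * P.hamiltonian N x) * φ x with hA
  -- the odd-moment pairing decays exponentially, uniformly in `δ`
  have hwit : ∃ δ' : ℝ, δ' ≠ 0 ∧ 0 < T + δ' / 2 ∧ 0 < T - δ' / 2 ∧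
      ϑ < 1 / max (T + δ' / 2) (T - δ' / 2) := by
    have h2 : |δ₀ / 2| < δ₀ := by rw [abs_of_pos (by positivity)]; linarith
    obtain ⟨h1, h2', h3⟩ := bath_facts_of_abs_lt hδ₀T hϑT h2
    exact ⟨δ₀ / 2, by positivity, h1, h2', h3⟩
  set Ψ : ℝ → ℝ := fun s => ∫ x, (∫ y, φ y ∂(P.transitionKernel N (T + δ / 2) (T - δ / 2)
      s.toNNReal x)) * (Real.exp (-1 / T * P.hamiltonian N x) *
        (x.2 ⟨0, hN⟩ ^ 2 - x.2 ⟨N - 1, by omega⟩ ^ 2)) with hΨ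
  -- the exact response identity
  have hid : Z * (∫ y, φ y ∂ν) - A = δ * (γ / (2 * T ^ 2)) * ∫ s in Ioi (0 : ℝ), Ψ s :=
    pinnedChain_exact_response_identity hω hl.le hβ hγ hN hT hTL hTR hϑ hϑ' hφ2 hφ' ν hinv
  set I : ℝ := ∫ s in Ioi (0 : ℝ), Ψ s with hI
  have hΨle : ∀ s : ℝ, 0 < s → |Ψ s| ≤ B * Real.exp (-c * s) := fun s hs =>
    abs_oddMoment_pairing_le_of_mixing hω hl.le hβ.le hγ hN hT hTL hTR hϑ hϑ' hφ2 hφ' hwit ν hCm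
      (hUM δ hδ ν inferInstance hinv') hs
  -- hence the time integral is at most `B/c`
  have hIle : |I| ≤ B / c := by
    have hbound : IntegrableOn (fun s : ℝ => B * Real.exp (-c * s)) (Ioi 0) :=
      ((exp_neg_integrableOn_Ioi 0 hc).const_mul B)
    have hae : ∀ᵐ s ∂(volume.restrict (Ioi (0 : ℝ))), ‖Ψ s‖ ≤ B * Real.exp (-c * s) := by
      rw [ae_restrict_iff' measurableSet_Ioi]
      exact Eventually.of_forall fun s hs => by rw [Real.norm_eq_abs]; exact hΨle s hs
    have h1 := norm_integral_le_of_norm_le hbound hae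
    rw [Real.norm_eq_abs] at h1
    refine h1.trans (le_of_eq ?_)
    rw [integral_const_mul, integral_exp_mul_Ioi (by linarith) 0]
    simp only [mul_zero, Real.exp_zero]
    field_simp
  -- the Gibbs expectation is `Z⁻¹ ∫ e^{-H/T} φ`
  have hgibbs : ∫ y, φ y ∂(P.gibbsMeasure N T) = Z⁻¹ * A := by
    rw [P.integral_gibbsMeasure, hA]
    have hZ' : (∫ x, P.gibbsDensity N T x) = Z := by
      refine integral_congr_ae (Eventually.of_forall fun x => ?_)
      show Real.exp _ = Real.exp _
      congr 1; ring
    rw [hZ']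
    congr 1
    refine integral_congr_ae (Eventually.of_forall fun x => ?_)
    show φ x * Real.exp _ = Real.exp _ * φ x
    rw [mul_comm]
    congr 2; ring
  -- conclusion
  have hdiff : (∫ y, φ y ∂ν) - ∫ y, φ y ∂(P.gibbsMeasure N T) =
      δ * (γ / (2 * T ^ 2)) * I / Z := by
    rw [hgibbs, eq_div_iff hZ0.ne', ← hid]
    field_simp
  rw [hdiff, abs_div, abs_of_pos hZ0, abs_mul, abs_mul, abs_of_pos (by positivity : 0 < γ / (2 * T ^ 2)),
    div_le_iff₀ hZ0]
  have hK : γ / (2 * T ^ 2) * (B / c) / Z * |δ| * Z = |δ| * (γ / (2 * T ^ 2)) * (B / c) := by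
    field_simp
  rw [hK]
  exact mul_le_mul_of_nonneg_left hIle (by positivity)

end LogDensity

end Summit.AtomisticToContinuum.FouriersLaw.Theorems.ExtensiveSnapshotIrreversibility.ClausiusBudget

end
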